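import Summits.Ventures.PercRepro.PendantIdentity

/-! # PercRepro — row-level facts for `(5a)_class` (p1, gen 4; proofs/P1-5a-class.md §4), all by `decide` -/

namespace PercRepro

/-- The three A-rows `ab|c|d = 4`, `ac|b|d = 7`, `ad|b|c = 11` (`a` with exactly one mark, the other two apart). -/
def aRows : Finset (Fin 15) := {4, 7, 11}

/-- The bad Y-rows of the fibre whose B-row is `s` (`s = ab|cd`: `ac|bd, ad|bc, abd|c, abc|d`; and so on);
empty unless `s` is a crossing row. -/
def badRows (s : Fin 15) : Finset (Fin 15) :=
  if s = 3 then {6, 8, 2, 1} else if s = 6 then {3, 8, 5, 1} else if s = 8 then {3, 6, 5, 2} else ∅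

/-- The fibre kernel on rows: `+1` on `(A-row, ⊤)`, `−1` on `(B-row, bad row)`. -/
def kf (s t : Fin 15) : ℤ := (if s ∈ aRows ∧ t = 0 then 1 else 0) - (if t ∈ badRows s then 1 else 0)

/-- The row with the first mark split off (`a` isolated, the partition of `b, c, d` kept). -/
def splitA (t : Fin 15) : Fin 15 := rowOf4 fun a : Fin 6 => if a.val < 3 then false else rows4 t a

/-- Refinement of rows: every pair connected in `s` is connected in `t`. -/
def RowLe (s t : Fin 15) : Prop := ∀ a : Fin 6, rows4 s a = true → rows4 t a = true

/-- `RowLe` is decidable (six atoms). -/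
instance : DecidableRel RowLe := fun _ _ => by unfold RowLe; infer_instance

/-- The fibre kernel with the X-side as a bit (`true` = the B-row `p`, `false` = its A-row). -/
def fB (p : Fin 15) (x : Bool) (t : Fin 15) : ℤ :=
  if x then -(if t ∈ badRows p then 1 else 0) else (if t = 0 then 1 else 0)

/-- The A-row of a B-row. -/
def aRowOf (p : Fin 15) : Fin 15 := if p = 3 then 4 else if p = 6 then 7 else 11

/-- **The pointwise kernel bound** (225 cases): the defect `K⁺(s, t) − K⁺(s, split_a t)`, corrected by the
involution terms moving `(⊤, A-row)` to `(A-row, ⊤)`, is at most `−kf s t`. -/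
theorem kd_le_neg_kf : ∀ s t : Fin 15,
    kplusZ s t - kplusZ s (splitA t) + (if s = 0 ∧ t ∈ aRows then 1 else 0) -
      (if s ∈ aRows ∧ t = 0 then 1 else 0) ≤ -kf s t := by
  decide

/-- **The local inequality** on `{false < true} × rows` for each of the three fibre kernels. -/
theorem fB_loc : ∀ p ∈ ({3, 6, 8} : Finset (Fin 15)), ∀ (x₀ x₁ : Bool) (t₀ t₁ : Fin 15),
    x₀ ≤ x₁ → RowLe t₀ t₁ → fB p x₀ t₀ + fB p x₁ t₁ ≤ fB p x₀ t₁ + fB p x₁ t₀ := by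
  decide

/-- On the rows of a fibre the kernel `kf` is the fibre kernel `fB`. -/
theorem kf_eq_fB : ∀ p ∈ ({3, 6, 8} : Finset (Fin 15)), ∀ (x : Bool) (t : Fin 15),
    kf (if x then p else aRowOf p) t = fB p x t := by
  decide

/-- The bad rows separate the marks `q, r` of the fibre (`p = 3`: `c, d`; `p = 6`: `b, d`; `p = 8`: `b, c`). -/
theorem badRows_sep : ∀ t : Fin 15,
    (t ∈ badRows 3 → rows4 t 5 = false) ∧ (t ∈ badRows 6 → rows4 t 4 = false) ∧
      (t ∈ badRows 8 → rows4 t 3 = false) := by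
  decide

/-- The rows of a fibre with mark `b` in the cluster of `a`. -/
theorem rowOf4_fibre_b (x : Bool) : rowOf4 ![true, false, false, false, false, x] = if x then 3 else 4 := by
  cases x <;> decide

/-- The rows of a fibre with mark `c` in the cluster of `a`. -/
theorem rowOf4_fibre_c (x : Bool) : rowOf4 ![false, true, false, false, x, false] = if x then 6 else 7 := by
  cases x <;> decide

/-- The rows of a fibre with mark `d` in the cluster of `a`. -/
theorem rowOf4_fibre_d (x : Bool) : rowOf4 ![false, false, true, x, false, false] = if x then 8 else 11 := by
  cases x <;> decide

/-- If the first three atoms do not have exactly one `true`, the kernel `kf` vanishes on the row (64 × 15). -/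
theorem kf_eq_zero_of_not_one : ∀ b0 b1 b2 b3 b4 b5 : Bool, IsEquivAtoms4 ![b0, b1, b2, b3, b4, b5] →
    ¬ ((b0 = true ∧ b1 = false ∧ b2 = false) ∨ (b0 = false ∧ b1 = true ∧ b2 = false) ∨
        (b0 = false ∧ b1 = false ∧ b2 = true)) →
      ∀ t, kf (rowOf4 ![b0, b1, b2, b3, b4, b5]) t = 0 := by
  decide

/-- The row of a transitive atom vector has that vector as its atoms. -/
theorem rows4_rowOf4 (v : Fin 6 → Bool) (hv : IsEquivAtoms4 v) : rows4 (rowOf4 v) = v :=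
  ((rowOf4_eq_iff v hv (rowOf4 v)).1 rfl).symm

/-- `splitA` of a row: the atoms of the split row. -/
theorem rows4_splitA (t : Fin 15) :
    rows4 (splitA t) = fun a : Fin 6 => if a.val < 3 then false else rows4 t a := by
  revert t; decide

end PercRepro
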